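import Summits.AtomisticToContinuum.Crystallization.Theorems.RadialDefectsVanish.Negative.NearGroundStatesEnergy

/-!
# Crux `GappedShellCensus.RadialDefectsVanish` (stmt-AtomisticToContinuum-15930) — negative lemmas, gen 2:
# MINIMALITY IS LOAD-BEARING TO EVERY ORDER (III: the refutation of `RadialDefectsVanishNear κ`, `κ > 0`)

Crux disprover (cdisprove gen 2); dossier `Cruxes/RadialDefectsVanish/Disproof.lean` §6.
`not_radialDefectsVanishNear : 0 < κ → ¬ RadialDefectsVanishNear κ`, although
`RadialDefectsVanishNear 0 ↔ RadialDefectsVanish`: for every `κ > 0` the witness sequence `wit κ K`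
(`K ≈ 2/κ`; eventually the mixture `mix K M`, `eventually_mix_near`, using `E(N)/N → e*`,
`M·e* ≤ E(M)`, `e* < 0`) consists of `κ`-near ground states and has `≥ M/(K+1)`
radially bad sites at EVERY scale, for all large `M`.  Consequences: a proof of the crux must use
`E(x^N) − E(N) = o(N)`; and `radialCoercivity_cap`: a linear radial coercivity constant `g`
(`g·#bad_a(x) ≤ E_LJ(x) − M·e*` for all finite injective `x`, some `a ∈ (0, 1]`) is
`≤ (1 − (20/21)⁶)·|e*| ≈ 0.254·|e*|` (test on the `K = 1` mixture).
-/

noncomputable section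

open scoped Classical
open Filter
open Literature.MathematicalPhysics.StatisticalMechanics
open Summit.AtomisticToContinuum.Crystallization.Theses.GappedShellCensus
open Summit.AtomisticToContinuum.Crystallization.Theorems.ChargedEnergyGapNegative (eStar card_mul_eStar_le
  crysEnergyLimit eStar_le_groundStateEnergy_div e0 norm_e0 e0_ne_zero dimer dimer_injective
  interactionEnergy_dimer groundStateEnergy_nonpos)
open Summit.AtomisticToContinuum.Crystallization.Theorems.SlackRigidityNegative (gs gs_isGroundState)

namespace Summit.AtomisticToContinuum.Crystallization.Theorems.RadialDefectsVanish.Negative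


/-- **The mixture is eventually a `κ`-near ground state** (`0 < κ ≤ 1`, `κ·(K+1) ≥ 2`): its energy is
`≤ (K + (20/21)⁶)·E(N) ≤ (K + c)·N·(e* + ε)` with `E(N)/N → e*` (tree `crysEnergyLimit`), while
`(1 − κ)·E(M) ≥ (1 − κ)·M·e*` (tree `N·e* ≤ E(N)`), and `(K + c) > (1 − κ)(K + 1) + 1`. [folklore] -/
theorem eventually_mix_near {κ : ℝ} (hκ0 : 0 < κ) (hκ1 : κ ≤ 1) {K : ℕ} (hK2 : 2 ≤ κ * (K + 1)) :
    ∀ᶠ M : ℕ in atTop,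
      interactionEnergy lennardJones (mix K M) ≤ (1 - κ) * groundStateEnergy lennardJones 3 M := by
  have he : eStar < 0 := by
    have h1 := eStar_le_groundStateEnergy_div (N := 2) two_pos
    have h2 := groundStateEnergy_lennardJones_le (d := 3) dimer_injective
    rw [interactionEnergy_dimer] at h2
    have h3 : groundStateEnergy lennardJones 3 2 / (2 : ℕ) ≤ -1 / 24 := by
      push_cast; linarith
    linarith
  set ε : ℝ := -eStar / (2 * (K + 1)) with hε
  have hK1 : (0 : ℝ) < K + 1 := by positivity
  have hεpos : 0 < ε := div_pos (by linarith) (by positivity)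
  have hev : ∀ᶠ N : ℕ in atTop, groundStateEnergy lennardJones 3 N / N ∈ Set.Iio (eStar + ε) :=
    crysEnergyLimit (Iio_mem_nhds (by unfold eStar; linarith))
  obtain ⟨N₀, hN₀⟩ := eventually_atTop.1 (hev.and (eventually_ge_atTop 1))
  refine eventually_atTop.2 ⟨(K + 1) * max N₀ (2 * K), fun M hM => ?_⟩
  have hNge : max N₀ (2 * K) ≤ nBlk K M := by
    rw [nBlk, Nat.le_div_iff_mul_le (Nat.succ_pos K), mul_comm]; exact hM
  obtain ⟨hEN, hN1⟩ := hN₀ _ (le_of_max_le_left hNge)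
  have h2K : 2 * K ≤ nBlk K M := le_of_max_le_right hNge
  have hmix := interactionEnergy_mix_le K M
  set N := nBlk K M with hN
  have hNr : (1 : ℝ) ≤ N := by exact_mod_cast hN1
  have h2Kr : 2 * (K : ℝ) ≤ N := by exact_mod_cast h2K
  have hENr : groundStateEnergy lennardJones 3 N ≤ N * eStar + N * ε := by
    have h' := hEN
    rw [Set.mem_Iio, div_lt_iff₀ (by linarith)] at h'
    unfold eStar at h' ⊢
    linarith
  have hMle : (M : ℝ) ≤ (K + 1) * N + K := by
    have h1 := nBlk_spec K M
    have hr : nRem K M ≤ K := Nat.lt_succ_iff.1 (Nat.mod_lt _ (Nat.succ_pos K))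
    have h1' : (M : ℝ) = (K + 1) * N + nRem K M := by rw [hN]; exact_mod_cast h1
    have hr' : (nRem K M : ℝ) ≤ K := by exact_mod_cast hr
    linarith
  have hMpos : 0 < M := by
    have h1 := nBlk_spec K M
    have h1' : 1 ≤ nBlk K M := hN1
    nlinarith
  have hEM : (M : ℝ) * eStar ≤ groundStateEnergy lennardJones 3 M := by
    have h' := eStar_le_groundStateEnergy_div hMpos
    rwa [le_div_iff₀ (by exact_mod_cast hMpos), mul_comm] at h'
  have hc0 : (0 : ℝ) ≤ dil⁻¹ ^ 6 := by positivity
  have hc1 : dil⁻¹ ^ 6 ≤ 1 := by norm_num [dil]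
  set c := dil⁻¹ ^ 6 with hc
  set E := groundStateEnergy lennardJones 3 N with hE
  set EM := groundStateEnergy lennardJones 3 M with hEM'
  have s3 : (K + c) * E ≤ (K + c) * (N * eStar + N * ε) :=
    mul_le_mul_of_nonneg_left hENr (by positivity)
  have s4 : (K + c) * (N * ε) ≤ -(N * eStar) / 2 := by
    have h' : (K + c) * (N * ε) ≤ (K + 1) * (N * ε) :=
      mul_le_mul_of_nonneg_right (by linarith) (by positivity)
    have h'' : ((K : ℝ) + 1) * (N * ε) = -(N * eStar) / 2 := by
      rw [hε]; field_simp
    linarith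
  have hNe : (N : ℝ) * eStar ≤ 0 := by nlinarith
  have s6 : (K + c) * (N * eStar) ≤ (K - 1) * (N * eStar) + N * eStar := by
    have h' : c * (N * eStar) ≤ 0 := mul_nonpos_of_nonneg_of_nonpos hc0 hNe
    nlinarith
  have s7 : (N : ℝ) * eStar / 2 ≤ K * eStar := by nlinarith
  have s8 : ((K : ℝ) - 1) * (N * eStar) ≤ (1 - κ) * (K + 1) * (N * eStar) := by
    have hcoef : (1 - κ) * ((K : ℝ) + 1) ≤ K - 1 := by linarith
    nlinarith [mul_le_mul_of_nonpos_right hcoef hNe]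
  have s9 : (K : ℝ) * eStar ≤ (1 - κ) * (K * eStar) := by
    have h' : (K : ℝ) * eStar ≤ 0 := by nlinarith
    nlinarith
  have s10 : (1 - κ) * (((K + 1) * N + K) * eStar) ≤ (1 - κ) * EM := by
    apply mul_le_mul_of_nonneg_left _ (by linarith)
    calc (((K : ℝ) + 1) * N + K) * eStar ≤ M * eStar := mul_le_mul_of_nonpos_right hMle he.le
      _ ≤ EM := hEM
  have hsplit : ((K : ℝ) + c) * (N * eStar + N * ε) = (K + c) * (N * eStar) + (K + c) * (N * ε) := by
    ring
  linarith [hmix, s3, s4, s6, s7, s8, s9, s10, hsplit]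

/-- Every member of the witness sequence is a `κ`-near ground state (`κ ≥ 0`). [folklore] -/
theorem wit_isNearGroundState {κ : ℝ} (hκ : 0 ≤ κ) (K M : ℕ) : IsNearGroundState κ (wit κ K M) := by
  unfold wit
  split_ifs with h
  · exact ⟨mix_injective K M, h⟩
  · exact isNearGroundState_of_isGroundState hκ (gs_isGroundState M)

/-- Eventually the witness is the mixture. [folklore] -/
theorem wit_eventually_eq {κ : ℝ} (hκ0 : 0 < κ) (hκ1 : κ ≤ 1) {K : ℕ} (hK2 : 2 ≤ κ * (K + 1)) :
    ∀ᶠ M : ℕ in atTop, wit κ K M = mix K M :=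
  (eventually_mix_near hκ0 hκ1 hK2).mono fun M hM => by simp [wit, hM]

/-- The refutation for `0 < κ ≤ 1`. [folklore] -/
theorem not_radialDefectsVanishNear_of_le_one {κ : ℝ} (hκ0 : 0 < κ) (hκ1 : κ ≤ 1) :
    ¬ RadialDefectsVanishNear κ := by
  intro h
  obtain ⟨K, hK⟩ := exists_nat_ge (2 / κ)
  have hK2 : 2 ≤ κ * (K + 1) := by
    have h' : 2 ≤ κ * K := by rw [div_le_iff₀ hκ0] at hK; linarith
    nlinarith
  have hK1 : 1 ≤ K := by
    rcases Nat.eq_zero_or_pos K with h0 | h0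
    · subst h0; simp at hK2; linarith
    · exact h0
  obtain ⟨a, ha0, ha1, hθ⟩ := h (wit κ K) fun M => wit_isNearGroundState hκ0.le K M
  have hapos : 0 < a := by linarith
  have hKr : (0 : ℝ) < K + 1 := by positivity
  have hfr := hθ (1 / (2 * (K + 1))) (by positivity)
  obtain ⟨M, hbad, hwM, hM1⟩ :=
    (hfr.and_eventually ((wit_eventually_eq hκ0 hκ1 hK2).and (eventually_ge_atTop 1))).exists
  have hbad' : (Nat.card {i : Fin M // ¬ GoodAt a (mix K M) i} : ℝ) ≤ 1 / (2 * (K + 1)) * M := by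
    simpa only [isGappedTwelveAt_iff_goodAt, hwM] using hbad
  have hlow := le_natCard_bad_mix (K := K) hapos ha1 hK1 M
  have hM1r : (1 : ℝ) ≤ M := by exact_mod_cast hM1
  have hid : (M : ℝ) / (K + 1) = 2 * (1 / (2 * (K + 1)) * M) := by field_simp
  have hpos : 0 < (M : ℝ) / (K + 1) := by positivity
  linarith

/-- **MINIMALITY IS LOAD-BEARING TO EVERY ORDER.** For EVERY `κ > 0` the crux fails for sequences of
`κ`-near ground states (`E(x^N) ≤ (1 − κ)·E(N)`, i.e. binding within the fraction `κ` of optimal):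
witness = `K ≈ 2/κ` far-apart copies of a ground state plus one copy dilated by `21/20` — at EVERY scale
`a` at least `M/(K+1)` of its `M` sites are radially bad (scale exclusivity), for all `M` large.
Since `RadialDefectsVanishNear 0 ↔ RadialDefectsVanish` and the family is antitone in `κ`, the crux
sits exactly at the endpoint `κ = 0` of a family that is false on `(0, ∞)`: no argument that only uses
`E(x^N) ≤ (1 − κ)E(N)` for a fixed `κ > 0` (equivalently: energy within `κ|e*|` per particle) can
prove it; a proof must exploit `E(x^N) − E(N) = o(N)` (here: `= 0`). Quantitatively, bad FRACTION
`θ` is compatible with excess energy `≈ (1 − (20/21)⁶)·|e*|·θ ≈ 0.25·|e*|·θ` per particle, so any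
coercivity constant `g` in "excess ≥ g·#bad" obeys `g ≤ 0.254·|e*|` (numerics: true `g ≈ |e*|/400`).
[folklore] -/
theorem not_radialDefectsVanishNear {κ : ℝ} (hκ : 0 < κ) : ¬ RadialDefectsVanishNear κ := fun h =>
  not_radialDefectsVanishNear_of_le_one (lt_min hκ one_pos) (min_le_right _ _)
    (h.anti (min_le_left _ _))

/-- **Certified cap on linear radial coercivity.** If `g·#bad_a(x) ≤ E_LJ(x) − M·e*` for ALL finite
injective configurations `x` of `ℝ³` at some scale `a ∈ (0, 1]` (`#bad_a` = number of sites that are not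
gapped-twelve at scale `a`), then `g ≤ (1 − (20/21)⁶)·|e*| ≈ 0.254·|e*|`: test the inequality on the
mixture with `K = 1` (a ground state of `N` particles next to its `21/20`-dilate; `≥ N` of its `2N`
sites are bad at every scale, its excess energy is `≤ (1 − (20/21)⁶)·N·|e*| + o(N)`). [folklore] -/
theorem radialCoercivity_cap {a g : ℝ} (ha0 : 0 < a) (ha1 : a ≤ 1)
    (h : ∀ (M : ℕ) (x : Fin M → (EuclideanSpace ℝ (Fin 3))), Function.Injective x →
      g * Nat.card {i : Fin M // ¬ GoodAt a x i} ≤ interactionEnergy lennardJones x - M * eStar) :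
    g ≤ (1 - dil⁻¹ ^ 6) * (-eStar) := by
  by_contra hlt
  push Not at hlt
  have he : eStar < 0 := by
    have h1 := eStar_le_groundStateEnergy_div (N := 2) two_pos
    have h2 := groundStateEnergy_lennardJones_le (d := 3) dimer_injective
    rw [interactionEnergy_dimer] at h2
    have h3 : groundStateEnergy lennardJones 3 2 / (2 : ℕ) ≤ -1 / 24 := by
      push_cast; linarith
    linarith
  have hc0 : (0 : ℝ) ≤ dil⁻¹ ^ 6 := by positivity
  have hc1 : dil⁻¹ ^ 6 ≤ 1 := by norm_num [dil]
  set c := dil⁻¹ ^ 6 with hc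
  set γ := g - (1 - c) * (-eStar) with hγ
  have hγpos : 0 < γ := by linarith
  have hgpos : 0 < g := by nlinarith
  have hev : ∀ᶠ N : ℕ in atTop, groundStateEnergy lennardJones 3 N / N ∈ Set.Iio (eStar + γ / 4) :=
    crysEnergyLimit (Iio_mem_nhds (by unfold eStar; linarith))
  obtain ⟨N, hEN, hN1⟩ := (hev.and (eventually_ge_atTop 1)).exists
  have hNr : (1 : ℝ) ≤ N := by exact_mod_cast hN1
  -- the mixture with K = 1 on M = 2N particles: nBlk 1 (2N) = N
  have hblk : nBlk 1 (2 * N) = N := by simp [nBlk]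
  have hM := h (2 * N) (mix 1 (2 * N)) (mix_injective 1 (2 * N))
  have hbad := le_natCard_bad_mix (K := 1) ha0 ha1 le_rfl (2 * N)
  have hmix := interactionEnergy_mix_le 1 (2 * N)
  rw [hblk] at hmix
  have hENr : groundStateEnergy lennardJones 3 N ≤ N * eStar + N * (γ / 4) := by
    have h' := hEN
    rw [Set.mem_Iio, div_lt_iff₀ (by linarith)] at h'
    unfold eStar at h' ⊢
    linarith
  push_cast at hM hbad hmix
  have hbad' : (N : ℝ) ≤ Nat.card {i : Fin (2 * N) // ¬ GoodAt a (mix 1 (2 * N)) i} := by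
    have : (2 * (N : ℝ)) / (1 + 1) = N := by ring
    linarith [hbad]
  have s1 : g * N ≤ g * Nat.card {i : Fin (2 * N) // ¬ GoodAt a (mix 1 (2 * N)) i} :=
    mul_le_mul_of_nonneg_left hbad' hgpos.le
  have s2 : ((1 : ℝ) + c) * groundStateEnergy lennardJones 3 N ≤ (1 + c) * (N * eStar + N * (γ / 4)) :=
    mul_le_mul_of_nonneg_left hENr (by linarith)
  have key : g * N ≤ N * ((1 - c) * (-eStar) + (1 + c) * (γ / 4)) := by
    have := hM
    nlinarith [s1, s2, hmix, this]
  have key2 : g ≤ (1 - c) * (-eStar) + (1 + c) * (γ / 4) := by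
    have := (mul_le_mul_iff_of_pos_right (by linarith : (0 : ℝ) < N)).1
      (by nlinarith [key] : g * N ≤ ((1 - c) * (-eStar) + (1 + c) * (γ / 4)) * N)
    exact this
  nlinarith [key2]

end Summit.AtomisticToContinuum.Crystallization.Theorems.RadialDefectsVanish.Negative

end
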